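import Summits.QuantumFields.YangMills.Theorems.FlatTubeReductionGroundStateOnionLayer
import Summits.QuantumFields.YangMills.Theorems.FlatTubeReductionGroundStateOnionArith
import Summits.QuantumFields.YangMills.Theorems.FemtoCutoffLadderFixedLatticeLawInnerRateBOPrelim
import Summits.QuantumFields.YangMills.Theorems.LuscherReductionRunningReductionCoarseUpperScales
import Summits.QuantumFields.YangMills.Theorems.LuscherReductionTwistedTraceScalingValleyBOUpperPow
import Summits.QuantumFields.YangMills.Theorems.LuscherReductionOneSiteLevelsClosed
import Summits.QuantumFields.YangMills.Theorems.FemtoTransferGapOneSiteScaling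
import Summits.QuantumFields.YangMills.Theorems.FemtoCutoffLadderLargeFieldInsensitivityCompression
import HarnessLib

/-!
# Route `FlatTubeReduction` (K1 `NearFlatRatioLaw` 24720, K1a′ 27141; pool `FixedLatticeLaw` 23943): PRELIMINARIES for the near-region tube ratio law
# from the inner no-intruder with rate (rung R2b1 = RECORD-label femto gap; no summit statement is proved here)

Seat `ym-line-ftr-p1` g4 (prover).  Support lemmas for `…NearRegionOfInnerRate`:
* §1 two-member families (`comb_two_eq`, `qform_comb_two`, `l2_comb_two`);
* §2 ★ `quad_endgame` — the two-case real argument isolating `ψ` from the min–max inequality of the family `(Ω_in, ψ)`;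
* §3 ★ `innerCut_facts` — the inner cut-off `Ω_in = cos Θ_{6ρ}·Ω` of the exact ground state and its complement `D = (1 − cos Θ_{6ρ})Ω`
  (physical, `Ω = Ω_in + D`, `‖D‖², ⟨D,Ω⟩ ≤ ‖sin Θ_{3ρ}Ω‖²`, `‖Ω_in‖² ∈ [‖Ω‖² − 2M, ‖Ω‖²]`, `⟨Ω_in,KΩ_in⟩ ≥ λ₀‖Ω‖² − 2λ₀M`, supports), and the real
  bookkeeping `quarter_le_exp_mul_exp`, `eight_div_le_sq`, `cb_small_real`.
HONEST FRAMING: glue over landed estimates; nothing here is infinite volume, a continuum limit or the Clay mass gap.  No definitions, no named facts,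
no `sorry`.  References: M. Lüscher, NPB 219 (1983) 233 [cite: Luscher1983, §3]; Reed–Simon IV [cite: ReedSimonIV1978, Thm. XIII.1].
-/

set_option autoImplicit false

noncomputable section

open MeasureTheory Filter Topology Real
open scoped Matrix BigOperators
open Literature.MathematicalPhysics.QuantumFieldTheory hiding SU2
open Literature.MathematicalPhysics.QuantumLattice

namespace Summit.QuantumFields.YangMills.Theorems.FemtoTransferGap

namespace GroundConc

open Summit.QuantumFields.YangMills.Theorems.FemtoTransferGap.OffTube
open Summit.QuantumFields.YangMills.Theorems.FemtoCutoffLadder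

variable {L : ℕ} [NeZero L]

/-! ## §1 Two-member families -/

omit [NeZero L] in
/-- The combination of the family `![F₀, F₁]` with coefficients `a` is `a₀•F₀ + a₁•F₁`. [folklore] -/
theorem comb_two_eq (F₀ F₁ : GaugeConfig 3 L SU2 → ℝ) (a : Fin 2 → ℝ) :
    (fun U => ∑ i, a i * (![F₀, F₁] : Fin 2 → GaugeConfig 3 L SU2 → ℝ) i U) = a 0 • F₀ + a 1 • F₁ := by
  funext U
  simp [Fin.sum_univ_two]

/-- `⟨sf + tg, K_β(sf + tg)⟩ = s²⟨f,Kf⟩ + 2st⟨f,Kg⟩ + t²⟨g,Kg⟩` for physical `f`, `g`. [folklore] -/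
theorem qform_comb_two (β s t : ℝ) {f g : GaugeConfig 3 L SU2 → ℝ} (hf : IsPhys f) (hg : IsPhys g) :
    qform su2Rep β (s • f + t • g) (s • f + t • g) =
      s ^ 2 * qform su2Rep β f f + 2 * (s * t) * qform su2Rep β f g + t ^ 2 * qform su2Rep β g g := by
  rw [OffTube.qform_add_add β (hf.smul s) (hg.smul t), qform_smul_left, OffTube.qform_smul_right β s hf hf, qform_smul_left,
    OffTube.qform_smul_right β t hf hg, qform_smul_left, OffTube.qform_smul_right β t hg hg]
  ring

/-- `‖sf + tg‖² = s²‖f‖² + 2st⟨f,g⟩ + t²‖g‖²` for physical `f`, `g`. [folklore] -/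
theorem l2_comb_two (s t : ℝ) {f g : GaugeConfig 3 L SU2 → ℝ} (hf : IsPhys f) (hg : IsPhys g) :
    l2 (s • f + t • g) (s • f + t • g) = s ^ 2 * l2 f f + 2 * (s * t) * l2 f g + t ^ 2 * l2 g g := by
  rw [OffTube.l2_add_add (hf.smul s) (hg.smul t), SFCompression.l2_smul_smul, SFCompression.l2_smul_smul, SFCompression.l2_smul_smul]
  ring

/-! ## §2 The two-case real argument -/

/-- ★ **The quadratic endgame.**  `Q = ⟨ψ,Kψ⟩ ≤ λ₀n`, `Q₀ = ⟨Ω_in,KΩ_in⟩ ≥ (1−2m)λ₀N`, `n₀ = ‖Ω_in‖² ≤ N = ‖Ω‖²`, the cross term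
`2|a₀a₁X| ≤ cb·(a₁²n + a₀²N)`, the min–max inequality `a₀²Q₀ + 2a₀a₁X + a₁²Q ≤ E(a₀²n₀ + a₁²n)` for some `(a₀,a₁) ≠ 0`, `E ≥ λ₀/4`, `8m ≤ u²`,
`cb ≤ (u²/8)λ₀`, `0 < u ≤ 1` ⟹ `Q ≤ e^{u²}·E·n` (case `E ≥ (1−u²/2)λ₀`: Rayleigh bound; else the `Ω_in`-coefficient has a negative sign and `a₁ ≠ 0`). [folklore] -/
theorem quad_endgame {Q Q₀ X n n₀ N E lam u cb m a₀ a₁ : ℝ} (hlam : 0 < lam) (hN : 0 < N) (hn : 0 ≤ n)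
    (hu0 : 0 < u) (hu1 : u ≤ 1) (hm : 8 * m ≤ u ^ 2) (hcb0 : 0 ≤ cb) (hcb : cb ≤ u ^ 2 / 8 * lam) (hE : lam / 4 ≤ E)
    (hQ : Q ≤ lam * n) (hQ₀ : (1 - 2 * m) * lam * N ≤ Q₀) (hn₀0 : 0 ≤ n₀) (hn₀ : n₀ ≤ N)
    (hX : 2 * |a₀ * a₁ * X| ≤ cb * (a₁ ^ 2 * n + a₀ ^ 2 * N))
    (ha : a₀ ≠ 0 ∨ a₁ ≠ 0)
    (hdoor : a₀ ^ 2 * Q₀ + 2 * (a₀ * a₁) * X + a₁ ^ 2 * Q ≤ E * (a₀ ^ 2 * n₀ + a₁ ^ 2 * n)) :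
    Q ≤ Real.exp (u ^ 2) * E * n := by
  have hE0 : 0 < E := lt_of_lt_of_le (by positivity) hE
  have hu2 : u ^ 2 ≤ 1 := by nlinarith
  have hexp1 : 1 + u ^ 2 ≤ Real.exp (u ^ 2) := by have := Real.add_one_le_exp (u ^ 2); linarith
  by_cases hcase : (1 - u ^ 2 / 2) * lam ≤ E
  · -- case A: `E` is near the top: Rayleigh bound
    have h1 : lam ≤ Real.exp (u ^ 2) * E := by
      have h2 : (1 - u ^ 2 / 2) * Real.exp (u ^ 2) ≥ 1 := by nlinarith
      nlinarith
    calc Q ≤ lam * n := hQ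
      _ ≤ (Real.exp (u ^ 2) * E) * n := mul_le_mul_of_nonneg_right h1 hn
      _ = Real.exp (u ^ 2) * E * n := by ring
  · -- case B: the `Ω_in` coefficient is negative
    rw [not_le] at hcase
    have hneg : E * n₀ - Q₀ ≤ -(u ^ 2 / 4) * lam * N := by
      have hb0 : 0 ≤ (1 - u ^ 2 / 2) * lam := by nlinarith
      have h1 : E * n₀ ≤ (1 - u ^ 2 / 2) * lam * N := mul_le_mul hcase.le hn₀ hn₀0 hb0
      have e1 : (1 - u ^ 2 / 2) * lam * N - (1 - 2 * m) * lam * N = (2 * m - u ^ 2 / 2) * (lam * N) := by ring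
      have h2 : (2 * m - u ^ 2 / 2) * (lam * N) ≤ -(u ^ 2 / 4) * (lam * N) :=
        mul_le_mul_of_nonneg_right (by linarith) (by positivity)
      have e2 : -(u ^ 2 / 4) * lam * N = -(u ^ 2 / 4) * (lam * N) := by ring
      linarith
    have habs : -(2 * (a₀ * a₁) * X) ≤ cb * (a₁ ^ 2 * n + a₀ ^ 2 * N) := by
      have h := neg_abs_le (a₀ * a₁ * X)
      have e : 2 * (a₀ * a₁) * X = 2 * (a₀ * a₁ * X) := by ring
      rw [e]; linarith [hX, abs_nonneg (a₀ * a₁ * X)]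
    -- `a₁² Q + ((u²/4)λ₀ − cb) N a₀² ≤ (E + cb) a₁² n`
    have hkey : a₁ ^ 2 * Q + (u ^ 2 / 4 * lam - cb) * N * a₀ ^ 2 ≤ (E + cb) * (a₁ ^ 2 * n) := by nlinarith [sq_nonneg a₀, sq_nonneg a₁]
    have hcoef : u ^ 2 / 8 * lam ≤ u ^ 2 / 4 * lam - cb := by linarith
    have hcoefpos : 0 < u ^ 2 / 8 * lam := by positivity
    -- `a₁ ≠ 0`
    have ha₁ : a₁ ≠ 0 := by
      intro h1
      rcases ha with h0 | h0
      · have hsq : 0 < a₀ ^ 2 := by positivity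
        rw [h1] at hkey
        simp only [zero_pow two_ne_zero, zero_mul, mul_zero, zero_add] at hkey
        have : 0 < (u ^ 2 / 4 * lam - cb) * N * a₀ ^ 2 := by
          have := mul_pos (mul_pos (lt_of_lt_of_le hcoefpos hcoef) hN) hsq
          linarith
        linarith
      · exact h0 h1
    have hsq : 0 < a₁ ^ 2 := by positivity
    have h2 : a₁ ^ 2 * Q ≤ (E + cb) * (a₁ ^ 2 * n) := by
      have : 0 ≤ (u ^ 2 / 4 * lam - cb) * N * a₀ ^ 2 := by
        have := mul_nonneg (mul_nonneg (hcoefpos.le.trans hcoef) hN.le) (sq_nonneg a₀)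
        linarith
      linarith
    have h3 : Q ≤ (E + cb) * n := by
      have e : (E + cb) * (a₁ ^ 2 * n) = a₁ ^ 2 * ((E + cb) * n) := by ring
      rw [e] at h2
      exact le_of_mul_le_mul_left h2 hsq
    have h4 : E + cb ≤ Real.exp (u ^ 2) * E := by
      have : cb ≤ u ^ 2 / 2 * E := by nlinarith
      nlinarith
    exact h3.trans (by nlinarith)


/-! ## §3 The inner cut-off of the exact ground state -/

/-- ★ **The inner cut-off `Ω_in = cos Θ_{6ρ}·Ω` of the exact ground state and its complement `D = (1 − cos Θ_{6ρ})Ω`**: both physical,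
`Ω = Ω_in + D`; `D` lives where every twisted orbit distance exceeds `3ρ` (so `‖D‖², ⟨D,Ω⟩ ≤ ‖sin Θ_{3ρ}Ω‖² ≤ M`); `‖Ω_in‖² ∈ [‖Ω‖² − 2M, ‖Ω‖²]`;
`⟨Ω_in, K_βΩ_in⟩ ≥ λ₀‖Ω‖² − 2λ₀M`; `Ω_in` lives in `{∃ z, orbitDist (τ_z U) < 6ρ}`. [cite: ReedSimonIV1978, Thm. XIII.1] -/
theorem innerCut_facts {β : ℝ} (hβ : 0 ≤ β) {ρ : ℝ} (hρ : 0 < ρ) {Ω : GaugeConfig 3 L SU2 → ℝ} (hΩ : IsPhys Ω)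
    (heig : transferApply β Ω = topValue su2Rep L β • Ω) {M : ℝ}
    (hM : l2 (fun U => Real.sin (innerPhase (3 * ρ) U) * Ω U) (fun U => Real.sin (innerPhase (3 * ρ) U) * Ω U) ≤ M) :
    IsPhys (fun U => Real.cos (innerPhase (6 * ρ) U) * Ω U) ∧
    IsPhys (fun U => (1 - Real.cos (innerPhase (6 * ρ) U)) * Ω U) ∧
    (Ω = (fun U => Real.cos (innerPhase (6 * ρ) U) * Ω U) + fun U => (1 - Real.cos (innerPhase (6 * ρ) U)) * Ω U) ∧
    l2 (fun U => (1 - Real.cos (innerPhase (6 * ρ) U)) * Ω U) (fun U => (1 - Real.cos (innerPhase (6 * ρ) U)) * Ω U) ≤ M ∧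
    l2 (fun U => (1 - Real.cos (innerPhase (6 * ρ) U)) * Ω U) Ω ≤ M ∧
    l2 (fun U => Real.cos (innerPhase (6 * ρ) U) * Ω U) (fun U => Real.cos (innerPhase (6 * ρ) U) * Ω U) ≤ l2 Ω Ω ∧
    l2 Ω Ω - 2 * M ≤ l2 (fun U => Real.cos (innerPhase (6 * ρ) U) * Ω U) (fun U => Real.cos (innerPhase (6 * ρ) U) * Ω U) ∧
    topValue su2Rep L β * l2 Ω Ω - 2 * topValue su2Rep L β * M ≤
      qform su2Rep β (fun U => Real.cos (innerPhase (6 * ρ) U) * Ω U) (fun U => Real.cos (innerPhase (6 * ρ) U) * Ω U) ∧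
    (∀ U, (1 - Real.cos (innerPhase (6 * ρ) U)) * Ω U ≠ 0 → ∀ z : Fin 3 → Bool, 3 * ρ < orbitDist (TT.twist3 z U)) ∧
    (∀ U, Real.cos (innerPhase (6 * ρ) U) * Ω U ≠ 0 → ∃ z : Fin 3 → Bool, orbitDist (TT.twist3 z U) < 6 * ρ) := by
  have h6ρ : 0 < 6 * ρ := by positivity
  have h3ρ : 0 < 3 * ρ := by positivity
  set lam := topValue su2Rep L β with hlam
  set Ωin : GaugeConfig 3 L SU2 → ℝ := fun U => Real.cos (innerPhase (6 * ρ) U) * Ω U with hΩin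
  set D : GaugeConfig 3 L SU2 → ℝ := fun U => (1 - Real.cos (innerPhase (6 * ρ) U)) * Ω U with hDdef
  set S : GaugeConfig 3 L SU2 → ℝ := fun U => Real.sin (innerPhase (3 * ρ) U) * Ω U with hSdef
  -- cut-off bookkeeping
  have hcm : Measurable fun U : GaugeConfig 3 L SU2 => Real.cos (innerPhase (6 * ρ) U) :=
    Real.continuous_cos.measurable.comp (measurable_innerPhase _)
  have hcb : ∀ U : GaugeConfig 3 L SU2, |Real.cos (innerPhase (6 * ρ) U)| ≤ 1 := fun U => Real.abs_cos_le_one _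
  have hc0 : ∀ U : GaugeConfig 3 L SU2, 0 ≤ Real.cos (innerPhase (6 * ρ) U) := fun U =>
    Real.cos_nonneg_of_mem_Icc ⟨by linarith [(innerPhase_mem (6 * ρ) U).1, Real.pi_pos], (innerPhase_mem (6 * ρ) U).2⟩
  have hc1 : ∀ U : GaugeConfig 3 L SU2, Real.cos (innerPhase (6 * ρ) U) ≤ 1 := fun U => Real.cos_le_one _
  have hcg : ∀ (k : Site 3 L → SU2) (U : GaugeConfig 3 L SU2), Real.cos (innerPhase (6 * ρ) (gaugeTransform k U)) = Real.cos (innerPhase (6 * ρ) U) :=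
    fun k U => by rw [innerPhase_gaugeTransform]
  have hcz : ∀ (k : Fin 3), ∀ z ∈ Subgroup.center SU2, ∀ U : GaugeConfig 3 L SU2,
      Real.cos (innerPhase (6 * ρ) (twist k z U)) = Real.cos (innerPhase (6 * ρ) U) := fun k z hz U => by rw [innerPhase_twist _ k hz]
  have hΩin' : IsPhys Ωin := hΩ.mul_of_invariant hcm (CJ := 1) hcb hcg hcz
  have hD' : IsPhys D := hΩ.mul_of_invariant (measurable_const.sub hcm) (CJ := 1)
    (fun U => by rw [abs_le]; constructor <;> linarith [hc0 U, hc1 U]) (fun k U => by rw [hcg k U]) (fun k z hz U => by rw [hcz k z hz U])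
  have hsum : Ω = Ωin + D := by funext U; simp only [hΩin, hDdef, Pi.add_apply]; ring
  -- supports
  have hDsupp : ∀ U, D U ≠ 0 → ∀ z : Fin 3 → Bool, 3 * ρ < orbitDist (TT.twist3 z U) := by
    intro U hU z
    by_contra hz
    rw [not_lt] at hz
    have hcos : Real.cos (innerPhase (6 * ρ) U) = 1 := cos_innerPhase_eq_one h6ρ ⟨z, by linarith⟩
    exact hU (by simp only [hDdef, hcos, sub_self, zero_mul])
  have hΩinsupp : ∀ U, Ωin U ≠ 0 → ∃ z : Fin 3 → Bool, orbitDist (TT.twist3 z U) < 6 * ρ := fun U hU =>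
    exists_orbitDist_lt_of_cos_ne_zero h6ρ (left_ne_zero_of_mul hU)
  have hDS : ∀ U, D U ≠ 0 → Real.sin (innerPhase (3 * ρ) U) = 1 := fun U hU =>
    sin_innerPhase_eq_one h3ρ fun z => (hDsupp U hU z).le
  -- pointwise comparisons with `S = sin Θ_{3ρ}·Ω`
  have hDD : ∀ U, D U * D U ≤ S U * S U := by
    intro U
    by_cases hU : D U = 0
    · rw [hU, mul_zero]; exact mul_self_nonneg _
    · have hs := hDS U hU
      simp only [hDdef, hSdef, hs, one_mul]
      have h1 : 0 ≤ 1 - Real.cos (innerPhase (6 * ρ) U) := by linarith [hc1 U]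
      have h2 : 1 - Real.cos (innerPhase (6 * ρ) U) ≤ 1 := by linarith [hc0 U]
      have h3 : (1 - Real.cos (innerPhase (6 * ρ) U)) ^ 2 ≤ 1 := by nlinarith
      nlinarith [mul_self_nonneg (Ω U)]
  have hDΩ : ∀ U, D U * Ω U ≤ S U * S U := by
    intro U
    by_cases hU : D U = 0
    · rw [hU, zero_mul]; exact mul_self_nonneg _
    · have hs := hDS U hU
      simp only [hDdef, hSdef, hs, one_mul]
      have h2 : 1 - Real.cos (innerPhase (6 * ρ) U) ≤ 1 := by linarith [hc0 U]
      nlinarith [mul_self_nonneg (Ω U)]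
  have hS : IsPhys S := hΩ.mul_of_invariant (Real.continuous_sin.measurable.comp (measurable_innerPhase _)) (CJ := 1)
    (fun U => Real.abs_sin_le_one _) (fun k U => by rw [innerPhase_gaugeTransform]) (fun k z hz U => by rw [innerPhase_twist _ k hz])
  have hlDD : l2 D D ≤ M := by
    refine le_trans ?_ hM
    unfold l2
    exact integral_mono (hD'.integrable_mul hD') (hS.integrable_mul hS) hDD
  have hlDΩ : l2 D Ω ≤ M := by
    refine le_trans ?_ hM
    unfold l2
    exact integral_mono (hD'.integrable_mul hΩ) (hS.integrable_mul hS) hDΩ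
  -- norms of `Ω_in`
  have hnle : l2 Ωin Ωin ≤ l2 Ω Ω := by
    unfold l2
    refine integral_mono (hΩin'.integrable_mul hΩin') (hΩ.integrable_mul hΩ) fun U => ?_
    simp only [hΩin]
    have h1 : Real.cos (innerPhase (6 * ρ) U) ^ 2 ≤ 1 := by nlinarith [hc0 U, hc1 U]
    nlinarith [mul_self_nonneg (Ω U)]
  have hnge : l2 Ω Ω - 2 * M ≤ l2 Ωin Ωin := by
    have h1 : l2 Ω Ω - 2 * l2 D Ω ≤ l2 Ωin Ωin := by
      unfold l2
      rw [← integral_const_mul, ← integral_sub (hΩ.integrable_mul hΩ) ((hD'.integrable_mul hΩ).const_mul _)]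
      refine integral_mono ((hΩ.integrable_mul hΩ).sub ((hD'.integrable_mul hΩ).const_mul _)) (hΩin'.integrable_mul hΩin') fun U => ?_
      simp only [hΩin, hDdef]
      nlinarith [mul_self_nonneg (Ω U), sq_nonneg (Real.cos (innerPhase (6 * ρ) U) - 1)]
    linarith
  -- the Rayleigh quotient of `Ω_in`
  have hq : lam * l2 Ω Ω - 2 * lam * M ≤ qform su2Rep β Ωin Ωin := by
    have hqΩ : qform su2Rep β Ω Ω = lam * l2 Ω Ω := qform_eigen_right β heig Ω
    have hexp : qform su2Rep β Ω Ω = qform su2Rep β Ωin Ωin + 2 * qform su2Rep β Ωin D + qform su2Rep β D D := by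
      conv_lhs => rw [hsum]
      exact OffTube.qform_add_add β hΩin' hD'
    obtain ⟨C1, hC1⟩ := hΩin'.bounded
    obtain ⟨C2, hC2⟩ := hD'.bounded
    have hcomm : qform su2Rep β Ωin D = qform su2Rep β D Ωin := FemtoCutoffLadder.qform_comm_bdd hΩin'.measurable hC1 hD'.measurable hC2
    have hDΩq : qform su2Rep β D Ω = lam * l2 D Ω := qform_eigen_right β heig D
    have hDsplit : qform su2Rep β D Ω = qform su2Rep β D Ωin + qform su2Rep β D D := by
      conv_lhs => rw [hsum]
      exact OffTube.qform_add_right β hD' hΩin' hD'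
    have hDD0 : 0 ≤ qform su2Rep β D D := qform_su2Rep_self_nonneg hβ hD'
    have hlam0 : 0 ≤ lam := (topValue_su2Rep_pos L β).le
    have h1 : lam * l2 D Ω ≤ lam * M := mul_le_mul_of_nonneg_left hlDΩ hlam0
    linarith
  exact ⟨hΩin', hD', hsum, hlDD, hlDΩ, hnle, hnge, hq, hDsupp, hΩinsupp⟩


/-- `1/4 ≤ e^{Cu²}·e^{−(Δu + C₁u²)}` once `0 < u ≤ 1/(|C|+|C₁|+|Δ|+1)` (the exponent is `≥ −1 ≥ log(1/4)`). [folklore] -/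
theorem quarter_le_exp_mul_exp {C C₁ Δ u : ℝ} (hu0 : 0 < u) (huτ : u ≤ 1 / (|C| + |C₁| + |Δ| + 1)) :
    1 / 4 ≤ Real.exp (C * u ^ 2) * Real.exp (-(Δ * u + C₁ * u ^ 2)) := by
  rw [← Real.exp_add]
  have hS : 0 < |C| + |C₁| + |Δ| + 1 := by positivity
  have hu1 : u ≤ 1 := huτ.trans (by rw [div_le_one hS]; linarith [abs_nonneg C, abs_nonneg C₁, abs_nonneg Δ])
  have hx : -1 ≤ C * u ^ 2 + -(Δ * u + C₁ * u ^ 2) := by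
    have hu2 : u ^ 2 ≤ u := by nlinarith
    have h2 : (|C| + |C₁| + |Δ| + 1) * u ≤ 1 := by
      have := mul_le_mul_of_nonneg_left huτ hS.le
      rwa [mul_one_div, div_self hS.ne'] at this
    have h3 : -(|C| * u ^ 2) ≤ C * u ^ 2 := by nlinarith [neg_abs_le C, sq_nonneg u]
    have h4 : Δ * u ≤ |Δ| * u := mul_le_mul_of_nonneg_right (le_abs_self _) hu0.le
    have h5 : C₁ * u ^ 2 ≤ |C₁| * u ^ 2 := mul_le_mul_of_nonneg_right (le_abs_self _) (sq_nonneg u)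
    have h6 : |C| * u ^ 2 ≤ |C| * u := mul_le_mul_of_nonneg_left hu2 (abs_nonneg C)
    have h7 : |C₁| * u ^ 2 ≤ |C₁| * u := mul_le_mul_of_nonneg_left hu2 (abs_nonneg C₁)
    nlinarith [abs_nonneg Δ]
  have h6 : Real.exp (-1) ≤ Real.exp (C * u ^ 2 + -(Δ * u + C₁ * u ^ 2)) := Real.exp_le_exp.2 hx
  have h7 : (1 : ℝ) / 4 ≤ Real.exp (-1) := by
    rw [Real.exp_neg, one_div]
    refine inv_anti₀ (Real.exp_pos _) ?_
    have := Real.exp_one_lt_d9; linarith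
  exact h7.trans h6

/-- `8/β ≤ u²` once `u³ = 2/(Aβ)` and `β ≥ 128A²` (`A, β, u > 0`). [folklore] -/
theorem eight_div_le_sq {u A β : ℝ} (hu : 0 < u) (hA : 0 < A) (hβ : 0 < β) (hu3 : u ^ 3 = 2 / (A * β)) (hβA : 128 * A ^ 2 ≤ β) :
    8 * (1 / β) ≤ u ^ 2 := by
  have h1 : (8 * (1 / β)) ^ 3 ≤ (u ^ 2) ^ 3 := by
    have e1 : (u ^ 2) ^ 3 = (u ^ 3) ^ 2 := by ring
    rw [e1, hu3]
    have e2 : (8 * (1 / β)) ^ 3 = 512 / β ^ 3 := by field_simp; norm_num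
    have e3 : (2 / (A * β)) ^ 2 = 4 / (A ^ 2 * β ^ 2) := by field_simp; ring
    rw [e2, e3, div_le_div_iff₀ (by positivity) (by positivity)]
    have : 512 * (A ^ 2 * β ^ 2) = (128 * A ^ 2) * (4 * β ^ 2) := by ring
    rw [this]
    have : 4 * β ^ 3 = β * (4 * β ^ 2) := by ring
    rw [this]
    exact mul_le_mul_of_nonneg_right hβA (by positivity)
  exact (pow_le_pow_iff_left₀ (by positivity) (by positivity) (by norm_num : (3 : ℕ) ≠ 0)).1 h1

/-- The cross-copy kernel bound at separation `2ρ` is below `(u²/8)·f·c_β^{|E|}` once the stretched exponential has won (pure real bookkeeping: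
`u = c_L β^{−1/3}`, `ρ = β^{−1/39}`). [folklore] -/
theorem cb_small_real (n : ℕ) {β f cL u ρ cb lat w : ℝ} (hβ1 : 1 ≤ β) (hn : 0 < (n : ℝ)) (hf : 0 < f) (hcL : 0 < cL) (hw : 0 < w)
    (hlat : 0 ≤ lat) (hu : u = cL * β ^ (-(1 : ℝ) / 3)) (hρ : ρ = β ^ (-(1 / 39 : ℝ)))
    (hcb : cb ≤ (4 * β ^ 2 / w) ^ n * Real.exp (-(β / 2 * ((2 * ρ) ^ 2 / n))) * lat)
    (h1 : 8 / (f * cL ^ 2) * (4 / w) ^ n * β ^ (2 * n + 1) * Real.exp (-(2 / n * β ^ ((37 : ℝ) / 39))) ≤ 1) :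
    cb ≤ u ^ 2 / 8 * (f * lat) := by
  have hβ0 : 0 < β := by linarith
  have hββ : ∀ x : ℝ, β * β ^ x = β ^ (1 + x) := fun x => by rw [Real.rpow_add hβ0, Real.rpow_one]
  have hexp1 : β / 2 * ((2 * ρ) ^ 2 / n) = 2 / n * β ^ ((37 : ℝ) / 39) := by
    rw [hρ, mul_pow, ← Real.rpow_mul_natCast hβ0.le]
    have e2 : β * β ^ (-(1 / 39 : ℝ) * (2 : ℕ)) = β ^ ((37 : ℝ) / 39) := by rw [hββ]; norm_num
    rw [← e2]; field_simp
  have e : (4 * β ^ 2 / w) ^ n = (4 / w) ^ n * β ^ (2 * n) := by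
    rw [pow_mul, ← mul_pow]; congr 1; field_simp
  rw [hexp1, e] at hcb
  set X : ℝ := (4 / w) ^ n * β ^ (2 * n) * Real.exp (-(2 / n * β ^ ((37 : ℝ) / 39))) with hX
  have hX0 : 0 ≤ X := by positivity
  have hu2 : u ^ 2 = cL ^ 2 * β ^ (-(1 : ℝ) / 3 * (2 : ℕ)) := by rw [hu, mul_pow, ← Real.rpow_mul_natCast hβ0.le]
  have hβ23 : β ^ (-(1 : ℝ) / 3 * (2 : ℕ)) * β = β ^ ((1 : ℝ) / 3) := by
    rw [mul_comm, hββ]; norm_num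
  have hβ13 : 1 ≤ β ^ ((1 : ℝ) / 3) := Real.one_le_rpow hβ1 (by norm_num)
  have h3 : 8 / (f * cL ^ 2) * (4 / w) ^ n * β ^ (2 * n + 1) * Real.exp (-(2 / n * β ^ ((37 : ℝ) / 39))) = 8 * X * β / (f * cL ^ 2) := by
    rw [hX, pow_add, pow_one]; field_simp
  rw [h3, div_le_one (by positivity)] at h1
  have hfc : 0 < f * cL ^ 2 := by positivity
  have h4 : 8 * X * β ≤ (f * cL ^ 2 * β ^ (-(1 : ℝ) / 3 * (2 : ℕ))) * β := by
    conv_rhs => rw [mul_assoc, hβ23]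
    calc 8 * X * β ≤ f * cL ^ 2 := h1
      _ = f * cL ^ 2 * 1 := (mul_one _).symm
      _ ≤ f * cL ^ 2 * β ^ ((1 : ℝ) / 3) := mul_le_mul_of_nonneg_left hβ13 hfc.le
  have hXle : 8 * X ≤ f * cL ^ 2 * β ^ (-(1 : ℝ) / 3 * (2 : ℕ)) := le_of_mul_le_mul_right h4 hβ0
  calc cb ≤ X * lat := by rw [hX]; exact hcb
    _ ≤ (u ^ 2 / 8 * f) * lat := by
        refine mul_le_mul_of_nonneg_right ?_ hlat
        rw [hu2]; linarith
    _ = u ^ 2 / 8 * (f * lat) := by ring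

end GroundConc

end Summit.QuantumFields.YangMills.Theorems.FemtoTransferGap

end
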